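import Literature.NumberTheory.GaloisRepresentations.LocalCyclicLayerClassModule
import Literature.Algebra.Homology.BrauerGroupInflationRestriction
import Literature.Algebra.Homology.NormGroups
import Literature.Algebra.Homology.FiniteCyclicH2CarryCocycle
import HarnessLib

/-!
# The fundamental class of a CYCLIC layer `(Gal(L/K), Lˣ)` of a non-archimedean local field
# normalised by the norm residue symbol: a class module structure whose abstract reciprocity map IS a
# given `ψ : Kˣ → Gal(L/K)` onto with kernel `N_{L/K} Lˣ` — e.g. the local reciprocity law's
# `( , L/K)` (Serre, *Local Fields* XIII §4 Thm. 2; Neukirch, *Bonn Lectures* II §1 (1.9))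

Topic `NumberTheory/GaloisRepresentations` (local class field theory); namespace
`Literature.NumberTheory.GaloisRepresentations.UnitsLayer`.  Proof file: theorems only (no definition,
no named fact, no instance, no notation, no `sorry`; D-0026).  The local twin of
`Automorphic/IdeleClassGroupCyclicLayerArtinClass`: sequel to `LocalCyclicLayerClassModule` (door-c6 g8,
`exists_isClassModule_units`: cyclic layers of a local field are class modules, generator obtained
abstractly), the engine's `NormGroups` (`IsClassModule.normResidueSymbol`,
`normResidueSymbol_nakayamaSum : (Σ_τ φ(τ,g), ·) = ḡ⁻¹`), `FiniteCyclicH2CarryCocycle` (carry cocycle,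
`normResidueCarryEquiv`) and `CyclicExtensionUnitsCohomology` (`unitsOfBase : Kˣ → (Lˣ)^G`,
`unitsOfBase_surjective`, `unitsOfBase_unitsNorm`).

For `L/K` a cyclic extension of a non-archimedean local field and ANY `ψ : Kˣ → Gal(L/K)` onto with
kernel `N_{L/K}(Lˣ)` (the local reciprocity law `localReciprocityLaw_holds` provides one, through the
embedded copy of `L` in `K̄`), there is `φ` with `IsClassModule (Rep.ofAlgebraAutOnUnits K L) φ` and
`(a, L/K)_φ = ψ(a)` for every `a ∈ Kˣ` (`exists_isClassModule_units_normResidueSymbol_eq`): `φ = c · a₀`,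
the carry cocycle of a generator `σ` on `a₀ ∈ Kˣ ⊆ (Lˣ)^G` with `ψ(a₀) = σ⁻¹`.  Consequence
(`exists_isClassModule_units_normResidueSymbol`): some fundamental class has a norm residue symbol
`Kˣ ↠ Gal(L/K)^{ab}` with kernel exactly the norms — pinned by a reciprocity law proved in the tree
cohomology-free (Neukirch's Weil-datum route), in place of the invariant map.

## References
* J.-P. Serre, *Local Fields*, GTM 67 (1979), XIII §4 Thm. 2 and Cor. to Prop. 8 (the norm residue
  symbol `( , L/K)`, onto `Gal(L/K)`, kernel `N Lˣ`). [SerreLocalFields1979]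
* J. Neukirch, *Class Field Theory — The Bonn Lectures* (2013), II §1 Thm. (1.9) and the Nakayama
  map. [Neukirch2013]
-/

noncomputable section

open CategoryTheory CategoryTheory.Limits groupCohomology

namespace Literature.NumberTheory.GaloisRepresentations

namespace UnitsLayer

open Literature.Algebra.Homology

/-- In a cyclic group generated by `s`, given a surjection `ψ` onto it: every `x` is `x₀ ^ k · n` with
`ψ n = 1`, for any `x₀` with `ψ x₀ = s`. [folklore] -/
private theorem exists_zpow_mul_mem_ker {M G : Type} [CommGroup M] [Group G] (ψ : M →* G) {s : G}
    (hs : ∀ g, g ∈ Subgroup.zpowers s) {x₀ : M} (hx₀ : ψ x₀ = s) (x : M) :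
    ∃ (k : ℤ) (n : M), n ∈ ψ.ker ∧ x = x₀ ^ k * n := by
  obtain ⟨k, hk⟩ := Subgroup.mem_zpowers_iff.1 (hs (ψ x))
  refine ⟨k, (x₀ ^ k)⁻¹ * x, ?_, by rw [mul_inv_cancel_left]⟩
  rw [MonoidHom.mem_ker, map_mul, map_inv, map_zpow, hx₀, hk, inv_mul_cancel]

section AnyField

variable {K L : Type} [Field K] [Field L] [Algebra K L] [FiniteDimensional K L] [IsGalois K L]

/-- **`N_{L/K}(Lˣ) ⊆ N_G Lˣ`** on the engine's carriers: for `a = N_{L/K} u`, the invariant vector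
`unitsOfBase a ∈ (Lˣ)^G` is the norm element `N_G u` (`CyclicExtension.unitsOfBase_unitsNorm`).
[cite: SerreLocalFields1979, Ch. XIII §2 Cor. to Prop. 5 (proof)] -/
theorem unitsOfBase_mem_range_norm_of_mem_range {a : Kˣ}
    (ha : a ∈ (Units.map (Algebra.norm K : L →* K)).range) :
    ((CyclicExtension.unitsOfBase K L (Additive.ofMul a)).1 : (Rep.ofAlgebraAutOnUnits K L).V) ∈
      LinearMap.range (Rep.ofAlgebraAutOnUnits K L).ρ.norm := by
  obtain ⟨u, rfl⟩ := ha
  exact ⟨Additive.ofMul u, (CyclicExtension.unitsOfBase_unitsNorm K L (Additive.ofMul u)).symm⟩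

end AnyField

section LocalField

variable (K : Type) [Field K] [ValuativeRel K] [TopologicalSpace K] [IsNonarchimedeanLocalField K]
variable (L : Type) [Field L] [Algebra K L] [FiniteDimensional K L] [IsGalois K L]

/-- **A cyclic layer `(Gal(L/K), Lˣ)` of a non-archimedean local field has a fundamental class with
prescribed norm residue symbol**: for any `ψ : Kˣ → Gal(L/K)` onto with kernel `N_{L/K}(Lˣ)` there is
`φ` with `IsClassModule (Rep.ofAlgebraAutOnUnits K L) φ` and `(a, L/K)_φ = ψ(a)` in `Gal(L/K)^{ab}` for
every `a ∈ Kˣ` — `φ = c · a₀`, the carry cocycle of a generator `σ` on `a₀ ∈ Kˣ`, `ψ(a₀) = σ⁻¹`.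
[cite: SerreLocalFields1979, Ch. XIII §4 Thm. 2][cite: Neukirch2013, Part II §1 Thm. (1.9)] -/
theorem exists_isClassModule_units_normResidueSymbol_eq [IsCyclic (L ≃ₐ[K] L)]
    (ψ : Kˣ →* (L ≃ₐ[K] L)) (hψ : Function.Surjective ψ)
    (hker : ψ.ker = (Units.map (Algebra.norm K : L →* K)).range) :
    ∃ (φ : cocycles₂ (Rep.ofAlgebraAutOnUnits K L)) (hA : IsClassModule (Rep.ofAlgebraAutOnUnits K L) φ),
      ∀ a : Kˣ,
        hA.normResidueSymbol (CyclicExtension.unitsOfBase K L (Additive.ofMul a)) =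
          Abelianization.of (ψ a) := by
  classical
  -- `ι̂ : Kˣ → (Lˣ)^G` multiplicatively
  let ιhat : Kˣ →* Multiplicative ((Rep.ofAlgebraAutOnUnits K L).ρ.invariants) :=
    AddMonoidHom.toMultiplicativeRight (CyclicExtension.unitsOfBase K L).toAddMonoidHom
  have hιhat : ∀ a : Kˣ, Multiplicative.toAdd (ιhat a) =
      CyclicExtension.unitsOfBase K L (Additive.ofMul a) := fun _ => rfl
  by_cases hG : Nontrivial (L ≃ₐ[K] L)
  swap
  · haveI : Subsingleton (L ≃ₐ[K] L) := not_nontrivial_iff_subsingleton.1 hG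
    obtain ⟨φ, hA⟩ := exists_isClassModule_units K L
    have h1 : ∀ y : Abelianization (L ≃ₐ[K] L), y = 1 := fun y => by
      induction y using QuotientGroup.induction_on with
      | H g => rw [Subsingleton.elim g 1]; rfl
    exact ⟨φ, hA, fun a => by rw [h1 (hA.normResidueSymbol _), h1 (Abelianization.of _)]⟩
  haveI := hG
  obtain ⟨σ, hσ⟩ := IsCyclic.exists_generator (α := L ≃ₐ[K] L)
  have hσ' : ∀ g : L ≃ₐ[K] L, g ∈ Subgroup.zpowers σ⁻¹ := fun g => by
    rw [Subgroup.zpowers_inv]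
    exact hσ g
  obtain ⟨a₀, ha₀⟩ := hψ σ⁻¹
  -- the invariant vector `a = a₀ ∈ Kˣ ⊆ (Lˣ)^G` and the carry cocycle `φ = c · a`
  set a : (Rep.ofAlgebraAutOnUnits K L).ρ.invariants :=
    CyclicExtension.unitsOfBase K L (Additive.ofMul a₀) with ha
  let φ : cocycles₂ (Rep.ofAlgebraAutOnUnits K L) :=
    Unramified.frobeniusCocycle σ hσ (Rep.ofAlgebraAutOnUnits K L)
      (a : (Rep.ofAlgebraAutOnUnits K L).V) fun g => a.2 g
  have hφ : H2π (Rep.ofAlgebraAutOnUnits K L) φ =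
      FiniteCyclic.normResidueCarryEquiv σ hσ (Rep.ofAlgebraAutOnUnits K L)
        (Submodule.Quotient.mk a) := rfl
  -- every `x ∈ Kˣ` is `a₀ ^ k · n` with `n` a norm
  have hdecomp : ∀ x : Kˣ, ∃ (k : ℤ) (n : Kˣ),
      n ∈ (Units.map (Algebra.norm K : L →* K)).range ∧ x = a₀ ^ k * n := fun x => by
    obtain ⟨k, n, hn, h⟩ := exists_zpow_mul_mem_ker ψ hσ' ha₀ x
    exact ⟨k, n, hker ▸ hn, h⟩
  have hnorm : ∀ n ∈ (Units.map (Algebra.norm K : L →* K)).range,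
      (Submodule.Quotient.mk (Multiplicative.toAdd (ιhat n)) :
        (Rep.ofAlgebraAutOnUnits K L).ρ.invariants ⧸
          LinearMap.range (normBar (Rep.ofAlgebraAutOnUnits K L).ρ)) = 0 := by
    intro n hn
    rw [Submodule.Quotient.mk_eq_zero, mem_range_normBar_iff, hιhat]
    exact unitsOfBase_mem_range_norm_of_mem_range hn
  -- `[a]` generates `(Lˣ)^G / N_G Lˣ`
  have hgen : AddSubgroup.zmultiples (Submodule.Quotient.mk a :
      (Rep.ofAlgebraAutOnUnits K L).ρ.invariants ⧸
        LinearMap.range (normBar (Rep.ofAlgebraAutOnUnits K L).ρ)) = ⊤ := by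
    rw [eq_top_iff]
    intro q _
    induction q using Submodule.Quotient.induction_on with
    | H s =>
      obtain ⟨b, hb⟩ := CyclicExtension.unitsOfBase_surjective K L s
      obtain ⟨k, n, hn, hx⟩ := hdecomp (Additive.toMul b)
      have hs : s = Multiplicative.toAdd (ιhat (a₀ ^ k * n)) := by
        rw [hιhat, ← hx, ofMul_toMul, hb]
      rw [hs, map_mul, map_zpow, toAdd_mul, toAdd_zpow, Submodule.Quotient.mk_add,
        Submodule.Quotient.mk_smul, hnorm n hn, add_zero]
      exact AddSubgroup.zsmul_mem _ (AddSubgroup.mem_zmultiples _) k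
  -- hence `[φ]` has order `|Gal(L/K)|`
  have hcardH0 : Nat.card ((Rep.ofAlgebraAutOnUnits K L).ρ.invariants ⧸
      LinearMap.range (normBar (Rep.ofAlgebraAutOnUnits K L).ρ)) = Nat.card (L ≃ₐ[K] L) := by
    rw [Nat.card_congr (FiniteCyclic.normResidueCarryEquiv σ hσ (Rep.ofAlgebraAutOnUnits K L)).toEquiv,
      natCard_H2_units_eq_card K L]
  have horder : addOrderOf (H2π (Rep.ofAlgebraAutOnUnits K L) φ) = Nat.card (L ≃ₐ[K] L) := by
    rw [hφ]
    change addOrderOf ((FiniteCyclic.normResidueCarryEquiv σ hσ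
      (Rep.ofAlgebraAutOnUnits K L)).toAddMonoidHom (Submodule.Quotient.mk a)) = _
    rw [addOrderOf_injective (FiniteCyclic.normResidueCarryEquiv σ hσ
        (Rep.ofAlgebraAutOnUnits K L)).toAddMonoidHom
      (FiniteCyclic.normResidueCarryEquiv σ hσ (Rep.ofAlgebraAutOnUnits K L)).injective, ← hcardH0,
      ← Nat.card_zmultiples, hgen, AddSubgroup.card_top]
  have hA : IsClassModule (Rep.ofAlgebraAutOnUnits K L) φ :=
    IsClassModule.of_card (fun U => InflationRestriction.isZero_H1_res_units K L U)
      (natCard_H2_res_units K L) horder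
  refine ⟨φ, hA, fun x => ?_⟩
  -- `(a, L/K) = σ = ψ(a₀)`: `Σ_τ φ(τ, σ) = a`
  have hcard1 : 1 < Fintype.card (L ≃ₐ[K] L) := Fintype.one_lt_card
  have hsum : Nakayama.nakayamaSum φ σ = a :=
    Subtype.ext (by
      rw [Nakayama.coe_nakayamaSum]
      exact Unramified.sum_frobeniusCocycle_self σ hσ (Rep.ofAlgebraAutOnUnits K L)
        (a : (Rep.ofAlgebraAutOnUnits K L).V) (fun g => a.2 g) hcard1)
  have ha_symbol : hA.normResidueSymbol a = Abelianization.of (ψ a₀) := by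
    rw [← hsum, hA.normResidueSymbol_nakayamaSum, ← map_inv, ha₀]
  obtain ⟨k, n, hn, rfl⟩ := hdecomp x
  have hsplit : CyclicExtension.unitsOfBase K L (Additive.ofMul (a₀ ^ k * n)) =
      k • a + Multiplicative.toAdd (ιhat n) := by
    rw [← hιhat, map_mul, map_zpow, toAdd_mul, toAdd_zpow]
    rfl
  have hn1 : hA.normResidueSymbol (Multiplicative.toAdd (ιhat n)) = 1 := by
    rw [hA.normResidueSymbol_eq_one_iff, hιhat]
    exact unitsOfBase_mem_range_norm_of_mem_range hn
  have hψn : ψ n = 1 := by rw [← MonoidHom.mem_ker, hker]; exact hn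
  have hhom : hA.normResidueSymbol (k • a + Multiplicative.toAdd (ιhat n)) =
      hA.normResidueSymbol a ^ k * hA.normResidueSymbol (Multiplicative.toAdd (ιhat n)) := by
    have h := map_add hA.normResidueHom (k • a) (Multiplicative.toAdd (ιhat n))
    rw [map_zsmul] at h
    simp only [IsClassModule.normResidueHom_apply] at h
    exact congrArg Additive.toMul h
  rw [hsplit, hhom, hn1, mul_one, ha_symbol, map_mul, hψn, mul_one, map_zpow, map_zpow]

/-- **… and such a `ψ` exists** (the local reciprocity law `localReciprocityLaw_holds`, Serre XIII §4:
`( , E/K) : Kˣ ↠ Gal(E/K)` with kernel `N Eˣ`, read for the embedded copy `E ≅ L` of `L` in `K̄`):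
**a cyclic layer of a local field has a fundamental class whose norm residue symbol `Kˣ → Gal(L/K)^{ab}`
is onto with kernel exactly `N_{L/K}(Lˣ)`.**
[cite: SerreLocalFields1979, Ch. XIII §4 Thm. 2 and Cor. to Prop. 8] -/
theorem exists_isClassModule_units_normResidueSymbol [IsCyclic (L ≃ₐ[K] L)] :
    ∃ (ψ : Kˣ →* (L ≃ₐ[K] L)) (φ : cocycles₂ (Rep.ofAlgebraAutOnUnits K L))
      (hA : IsClassModule (Rep.ofAlgebraAutOnUnits K L) φ),
      Function.Surjective ψ ∧ ψ.ker = (Units.map (Algebra.norm K : L →* K)).range ∧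
      ∀ a : Kˣ, hA.normResidueSymbol (CyclicExtension.unitsOfBase K L (Additive.ofMul a)) =
        Abelianization.of (ψ a) := by
  classical
  haveI : IsAbelianGalois K L := IsAbelianGalois.of_isCyclic K L
  obtain ⟨θ, hθ⟩ := localReciprocityLaw_holds K
  obtain ⟨hsurj, hkerθ, -⟩ := hθ (embeddedField K L)
  -- transport `θ_E : Kˣ → Gal(E/K)` to `Gal(L/K)` along `E ≅ L`
  let ψ : Kˣ →* (L ≃ₐ[K] L) := ((embeddedEquiv K L).autCongr.symm.toMonoidHom).comp (θ (embeddedField K L))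
  have hψsurj : Function.Surjective ψ := (embeddedEquiv K L).autCongr.symm.surjective.comp hsurj
  have hrange : (Units.map (Algebra.norm K : embeddedField K L →* K)).range =
      (Units.map (Algebra.norm K : L →* K)).range := by
    ext b
    constructor
    · rintro ⟨u, rfl⟩
      refine ⟨Units.map ((embeddedEquiv K L).symm : embeddedField K L →* L) u, Units.ext ?_⟩
      change Algebra.norm K ((embeddedEquiv K L).symm (u : embeddedField K L)) =
        Algebra.norm K (u : embeddedField K L)
      exact Algebra.norm_eq_of_algEquiv (embeddedEquiv K L).symm _
    · rintro ⟨u, rfl⟩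
      refine ⟨Units.map ((embeddedEquiv K L) : L →* embeddedField K L) u, Units.ext ?_⟩
      change Algebra.norm K ((embeddedEquiv K L) (u : L)) = Algebra.norm K (u : L)
      exact Algebra.norm_eq_of_algEquiv (embeddedEquiv K L) _
  have hψker : ψ.ker = (Units.map (Algebra.norm K : L →* K)).range := by
    rw [← hrange, ← hkerθ]
    ext b
    rw [MonoidHom.mem_ker, MonoidHom.mem_ker]
    exact (embeddedEquiv K L).autCongr.symm.map_eq_one_iff
  obtain ⟨φ, hA, h⟩ := exists_isClassModule_units_normResidueSymbol_eq K L ψ hψsurj hψker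
  exact ⟨ψ, φ, hA, hψsurj, hψker, h⟩

end LocalField

end UnitsLayer

end Literature.NumberTheory.GaloisRepresentations

end
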